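import Literature.Analysis.Complex.ArgumentPrincipleEdgeZeros
import HarnessLib

/-!
# The argument of an analytic function along an edge through its zeros

Trunk T-ANALYSIS support (`Literature/Analysis/Complex`). Companion of
`ArgumentPrincipleEdgeZeros.lean` (the argument principle with zeros on the left edge
`{a} × (c,d)` of a rectangle, whose left side is `∫_c^d Re (f'/f)(a+it) dt + π Σ m`, the change of
`arg f` up the edge "continued with the jump `+nπ` across a zero of multiplicity `n`") and of
`PhaseLevelCrossings.lean` (counting where such a phase is `≡ π/2 (mod π)`). Here we prove that
this phase really is the argument of `f` between the zeros (`leftEdge_phase_eq_sum`): if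
`f(a+ic) = ‖f(a+ic)‖ e^{iφ₀}`, then for every `t ∈ [c, d]` with `f(a+it) ≠ 0`,

  `f(a+it) = ‖f(a+it)‖ · exp(i (φ₀ + ∫_c^t Re (f'/f)(a+iu) du + π Σ_{c<s<t, f(a+is)=0} m(a+is)))`.

This is Conrey's convention "`arg Q(½ + it₁⁺) = arg Q(½ + it₁⁻) + nπ`" (*J. Number Theory* 16
(1983), §4) made into a theorem: the continuous part of the argument is the (Lebesgue) integral of
`Re f'/f` straight through the zeros (integrable, `Literature.Analysis.Complex.intervalIntegrable_re_logDeriv_left`),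
and the two one-sided determinations at a zero of multiplicity `n` differ by exactly `nπ`
(`(i(t − t₀))ⁿ` has argument `−nπ/2` below and `+nπ/2` above `t₀`).

Proof: on a zero-free edge, `G(t) = f(a+it)` and `Λ(t) = i ∫_c^t (f'/f)(a+iu) du` satisfy
`(G e^{−Λ})' = 0`, so `G(t) = G(c) e^{Λ(t)}` and `Im Λ(t) = ∫_c^t Re (f'/f)`
(`leftEdge_eq_mul_exp_integral`, `leftEdge_phase_eq_of_ne_zero`); in general, induction on the
zeros of the edge dividing out `(s − ρ)^m` as in `ArgumentPrincipleEdgeZeros.lean`.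

## Main results

* `isOpen_setOf_analyticAt_and_ne_zero` — `{z | f analytic at z, f z ≠ 0}` is open.
* `leftEdge_eq_mul_exp_integral` — `f(a+it) = f(a+ic) exp(i ∫_c^t (f'/f)(a+iu) du)` on a zero-free edge.
* `leftEdge_phase_eq_of_ne_zero` — the phase on a zero-free edge.
* `leftEdge_phase_eq_sum` — the phase through the zeros (finite-set form, matching
  `Literature.Analysis.Complex.exists_finset_cos_jumpPhase_eq_zero`).
* `exp_leftEdge_phase_at_zero` — the left value of the phase *at* a zero `ρ = a + it₀` of
  multiplicity `n` with `f = (s − ρ)ⁿ g` near `ρ`: `e^{iΦ(t₀⁻)} = (−i)ⁿ g(ρ)/‖g(ρ)‖` (limit from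
  below along the edge), which feeds the flag of `PhaseLevelCrossings.lean` into
  `Literature.Analysis.Complex.succ_le_analyticOrderAt_add_reflect` (`ReflectedSumOrder.lean`).

## References

* J. B. Conrey, *Zeros of derivatives of Riemann's ξ-function on the critical line*, J. Number
  Theory 16 (1983), 49–74, §4. [Conrey1983]
* J. B. Conway, *Functions of One Complex Variable I*, 2nd ed., GTM 11, Springer 1978, Ch. V §3.
-/

noncomputable section

open Complex Set MeasureTheory Filter Topology intervalIntegral

namespace Literature.Analysis.Complex

variable {a b c d : ℝ}

/-! ## A zero-free edge -/

/-- The set of points at which `f` is analytic and non-zero is open. [folklore] -/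
theorem isOpen_setOf_analyticAt_and_ne_zero (f : ℂ → ℂ) :
    IsOpen {z : ℂ | AnalyticAt ℂ f z ∧ f z ≠ 0} := by
  rw [isOpen_iff_eventually]
  rintro z ⟨hz, hz0⟩
  filter_upwards [(isOpen_analyticAt ℂ f).eventually_mem hz, hz.continuousAt.eventually_ne hz0]
    with w hw hw0
  exact ⟨hw, hw0⟩

/-- Elementary identity used to log-differentiate `(z-ρ)^m · f₁`. [folklore] -/
private lemma natCast_mul_pow_pred₃ (w : ℂ) (hw : w ≠ 0) (m : ℕ) :
    (m : ℂ) * w ^ (m - 1) = w ^ m * (m * w⁻¹) := by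
  cases m with
  | zero => simp
  | succ k =>
    rw [Nat.add_sub_cancel, pow_succ]
    field_simp

/-- `i^m = e^{imπ/2}`. [folklore] -/
private lemma I_pow_eq_exp (m : ℕ) : (I : ℂ) ^ m = exp (((m * (Real.pi / 2) : ℝ) : ℂ) * I) := by
  rw [show (((m * (Real.pi / 2) : ℝ) : ℂ)) * I = (m : ℂ) * (Real.pi / 2 * I) by push_cast; ring,
    Complex.exp_nat_mul, Complex.exp_pi_div_two_mul_I]

/-- `(-i)^m = e^{-imπ/2}`. [folklore] -/
private lemma neg_I_pow_eq_exp (m : ℕ) :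
    (-I : ℂ) ^ m = exp (((-(m * (Real.pi / 2)) : ℝ) : ℂ) * I) := by
  rw [show (((-(m * (Real.pi / 2)) : ℝ) : ℂ)) * I = (m : ℂ) * (-(Real.pi / 2 * I)) by push_cast; ring,
    Complex.exp_nat_mul, Complex.exp_neg, Complex.exp_pi_div_two_mul_I, inv_I]

/-- `‖ ‖z‖ e^{ix} ‖ = ‖z‖` for real `x`. [folklore] -/
private lemma norm_ofReal_norm_mul_exp_mul_I (z : ℂ) (x : ℝ) :
    ‖(‖z‖ : ℂ) * exp ((x : ℂ) * I)‖ = ‖z‖ := by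
  rw [norm_mul, Complex.norm_real, Complex.norm_exp_ofReal_mul_I, mul_one,
    Real.norm_of_nonneg (norm_nonneg _)]

/-- `e^{ix} e^{iy} = e^{i(x+y)}` for real `x, y`. [folklore] -/
private lemma exp_ofReal_mul_I_mul_exp (x y : ℝ) :
    exp ((x : ℂ) * I) * exp ((y : ℂ) * I) = exp (((x + y : ℝ) : ℂ) * I) := by
  rw [← exp_add]
  push_cast
  ring_nf

/-- **`f(a+it) = f(a+ic) · exp(i ∫_c^t (f'/f)(a+iu) du)` on a zero-free edge.** If `f` is analytic
and non-zero at every point `a + iu`, `c ≤ u ≤ d`, then for `c ≤ t ≤ d` the displayed identity holds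
(both sides solve `y' = i (f'/f)(a+it) y` with the same initial value). [folklore] -/
theorem leftEdge_eq_mul_exp_integral {f : ℂ → ℂ}
    (hf : ∀ u ∈ Icc c d, AnalyticAt ℂ f (a + u * I)) (h0 : ∀ u ∈ Icc c d, f (a + u * I) ≠ 0)
    {t : ℝ} (ht : t ∈ Icc c d) :
    f (a + t * I) = f (a + c * I) *
      exp (∫ u in c..t, I * (deriv f (a + u * I) / f (a + u * I))) := by
  -- the integrand and where it is continuous
  set F : ℝ → ℂ := fun u ↦ I * (deriv f (a + u * I) / f (a + u * I)) with hF
  set U : Set ℝ := (fun u : ℝ ↦ (a : ℂ) + u * I) ⁻¹' {z : ℂ | AnalyticAt ℂ f z ∧ f z ≠ 0} with hU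
  have hlin : Continuous fun u : ℝ ↦ (a : ℂ) + u * I := by fun_prop
  have hUopen : IsOpen U := (isOpen_setOf_analyticAt_and_ne_zero f).preimage hlin
  have hIU : Icc c d ⊆ U := fun u hu ↦ ⟨hf u hu, h0 u hu⟩
  have hFcont : ∀ u ∈ U, ContinuousAt F u := by
    rintro u ⟨hu, hu0⟩
    exact ((hu.deriv.continuousAt.comp (f := fun u : ℝ ↦ (a : ℂ) + u * I) hlin.continuousAt).div
      (hu.continuousAt.comp (f := fun u : ℝ ↦ (a : ℂ) + u * I) hlin.continuousAt) hu0).const_mul I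
  have hFcontOn : ContinuousOn F U := fun u hu ↦ (hFcont u hu).continuousWithinAt
  have hFmeas : ∀ u ∈ U, StronglyMeasurableAtFilter F (𝓝 u) volume :=
    hFcontOn.stronglyMeasurableAtFilter hUopen
  have hFint : ∀ t ∈ Icc c d, IntervalIntegrable F volume c t := fun t ht ↦
    (hFcontOn.mono ((Icc_subset_Icc le_rfl ht.2).trans hIU)).intervalIntegrable_of_Icc ht.1
  -- `Λ(t) = ∫_c^t F`, `G(t) = f(a+it)`, `H = G · exp(−Λ)` has zero derivative on `[c, d]`
  set Λ : ℝ → ℂ := fun t ↦ ∫ u in c..t, F u with hΛ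
  set H : ℝ → ℂ := fun t ↦ f (a + t * I) * exp (-Λ t) with hH
  have hderiv : ∀ t ∈ Icc c d, HasDerivAt H 0 t := by
    intro t ht
    have hΛ' : HasDerivAt Λ (F t) t :=
      intervalIntegral.integral_hasDerivAt_right (hFint t ht) (hFmeas t (hIU ht)) (hFcont t (hIU ht))
    have h1 : HasDerivAt (fun w : ℂ ↦ (a : ℂ) + w * I) (1 * I) (t : ℂ) :=
      ((hasDerivAt_id (t : ℂ)).mul_const I).const_add _
    have h2 : HasDerivAt (fun w : ℂ ↦ f (a + w * I)) (deriv f (a + t * I) * (1 * I)) (t : ℂ) :=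
      (hf t ht).differentiableAt.hasDerivAt.comp (t : ℂ) h1
    have hG : HasDerivAt (fun t : ℝ ↦ f (a + t * I)) (deriv f (a + t * I) * I) t := by
      simpa using h2.comp_ofReal
    have hE : HasDerivAt (fun t : ℝ ↦ exp (-Λ t)) (exp (-Λ t) * (-F t)) t := hΛ'.neg.cexp
    have hft := h0 t ht
    have hzero : deriv f (a + t * I) * I * exp (-Λ t) + f (a + t * I) * (exp (-Λ t) * -F t) = 0 := by
      simp only [hF]
      field_simp
      ring
    exact (hG.mul hE).congr_deriv hzero
  have hcont : ContinuousOn H (Icc c d) := fun t ht ↦ (hderiv t ht).continuousAt.continuousWithinAt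
  have hconst := constant_of_has_deriv_right_zero hcont
    (fun t ht ↦ (hderiv t (Ico_subset_Icc_self ht)).hasDerivWithinAt) t ht
  -- unwind
  have hΛc : Λ c = 0 := by simp [hΛ]
  simp only [hH, hΛc, neg_zero, exp_zero, mul_one] at hconst
  have hexp : exp (-Λ t) ≠ 0 := exp_ne_zero _
  calc f (a + t * I) = f (a + t * I) * exp (-Λ t) * exp (Λ t) := by
        rw [mul_assoc, ← exp_add, neg_add_cancel, exp_zero, mul_one]
    _ = f (a + c * I) * exp (Λ t) := by rw [hconst]

/-- **The phase on a zero-free edge.** If `f` is analytic and non-zero at every point `a + iu`,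
`c ≤ u ≤ d`, and `f(a+ic) = ‖f(a+ic)‖ e^{iφ₀}`, then for `c ≤ t ≤ d`,
`f(a+it) = ‖f(a+it)‖ exp(i(φ₀ + ∫_c^t Re (f'/f)(a+iu) du))`. [folklore] -/
theorem leftEdge_phase_eq_of_ne_zero {f : ℂ → ℂ}
    (hf : ∀ u ∈ Icc c d, AnalyticAt ℂ f (a + u * I)) (h0 : ∀ u ∈ Icc c d, f (a + u * I) ≠ 0)
    {φ₀ : ℝ} (hφ₀ : f (a + c * I) = ‖f (a + c * I)‖ * exp (φ₀ * I)) {t : ℝ} (ht : t ∈ Icc c d) :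
    f (a + t * I) = ‖f (a + t * I)‖ *
      exp (((φ₀ + ∫ u in c..t, (deriv f (a + u * I) / f (a + u * I)).re : ℝ) : ℂ) * I) := by
  have key := leftEdge_eq_mul_exp_integral hf h0 ht
  set Λ : ℂ := ∫ u in c..t, I * (deriv f (a + u * I) / f (a + u * I)) with hΛ
  -- `Im Λ = ∫ Re (f'/f)`
  have hcont : ContinuousOn (fun u : ℝ ↦ deriv f (a + u * I) / f (a + u * I)) (Icc c t) := by
    intro u hu
    have hu' : u ∈ Icc c d := ⟨hu.1, hu.2.trans ht.2⟩
    have hlin : Continuous fun u : ℝ ↦ (a : ℂ) + u * I := by fun_prop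
    exact (((hf u hu').deriv.continuousAt.comp (f := fun u : ℝ ↦ (a : ℂ) + u * I)
      hlin.continuousAt).div ((hf u hu').continuousAt.comp (f := fun u : ℝ ↦ (a : ℂ) + u * I)
      hlin.continuousAt) (h0 u hu')).continuousWithinAt
  have hint : IntervalIntegrable (fun u : ℝ ↦ I * (deriv f (a + u * I) / f (a + u * I)))
      volume c t := (hcont.intervalIntegrable_of_Icc ht.1).const_mul I
  have hIm : Λ.im = ∫ u in c..t, (deriv f (a + u * I) / f (a + u * I)).re := by
    have hcomm := Complex.imCLM.intervalIntegral_comp_comm hint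
    simp only [Complex.imCLM_apply] at hcomm
    rw [hΛ, ← hcomm]
    refine intervalIntegral.integral_congr fun u _ ↦ ?_
    simp only [I_mul_im]
  -- norms
  have hnorm : ‖f (a + t * I)‖ = ‖f (a + c * I)‖ * Real.exp Λ.re := by
    rw [key, norm_mul, Complex.norm_exp]
  have hexpΛ : exp Λ = (Real.exp Λ.re : ℂ) * exp (Λ.im * I) := by
    conv_lhs => rw [← re_add_im Λ, exp_add]
    rw [Complex.ofReal_exp]
  rw [hnorm, ← hIm, key, hφ₀, hexpΛ, norm_ofReal_norm_mul_exp_mul_I, Complex.ofReal_mul,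
    mul_mul_mul_comm, exp_ofReal_mul_I_mul_exp]

/-! ## Through the zeros of the edge -/

/-- **The argument along an edge through its zeros** (finite-set form). Let `f` be analytic at
every point of the closed rectangle `K = [a,b] × [c,d]` (`a < b`, `c < d`) with `f(a+ic) ≠ 0`,
`f(a+id) ≠ 0`, and let `S ⊆ (c, d)` be a finite set of reals containing the ordinate of every zero
of `f` on the left edge. If `f(a+ic) = ‖f(a+ic)‖ e^{iφ₀}`, then for every `t ∈ [c, d] ∖ S`,
`f(a+it) = ‖f(a+it)‖ exp(i(φ₀ + ∫_c^t Re(f'/f)(a+iu) du + π Σ_{s ∈ S, s < t} m(a+is)))`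
(`m = meromorphicOrderAt f`, `0` at the points of `S` where `f ≠ 0`): the argument of `f` along the
edge is the integral of `Re f'/f`, continued by `+nπ` across each zero of multiplicity `n`.
[cite: Conrey1983, §4 (after (1))] -/
theorem leftEdge_phase_eq_sum (hab : a < b) (hcd : c < d) (S : Finset ℝ) :
    ∀ f : ℂ → ℂ, AnalyticOnNhd ℂ f (Icc a b ×ℂ Icc c d) →
      f (a + c * I) ≠ 0 → f (a + d * I) ≠ 0 →
      (∀ y ∈ Icc c d, f (a + y * I) = 0 → y ∈ S) → ((S : Set ℝ) ⊆ Ioo c d) →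
      ∀ φ₀ : ℝ, f (a + c * I) = ‖f (a + c * I)‖ * exp (φ₀ * I) →
      ∀ t ∈ Icc c d, t ∉ S →
        f (a + t * I) = ‖f (a + t * I)‖ *
          exp (((φ₀ + (∫ u in c..t, (deriv f (a + u * I) / f (a + u * I)).re) +
            Real.pi * ∑ s ∈ S.filter (· < t), ((meromorphicOrderAt f (a + s * I)).untop₀ : ℝ) : ℝ) : ℂ) *
            I) := by
  classical
  induction S using Finset.induction_on with
  | empty =>
    intro f hf hfc hfd hzero _ φ₀ hφ₀ t ht _
    have h0 : ∀ u ∈ Icc c d, f (a + u * I) ≠ 0 := fun u hu h ↦ by simpa using hzero u hu h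
    have hf' : ∀ u ∈ Icc c d, AnalyticAt ℂ f (a + u * I) := fun u hu ↦
      hf _ ⟨by simpa using hab.le, by simpa using hu⟩
    have h := leftEdge_phase_eq_of_ne_zero hf' h0 hφ₀ ht
    simpa only [Finset.filter_empty, Finset.sum_empty, mul_zero, add_zero] using h
  | insert t₀ S' ht₀S' ih =>
    intro f hf hfc hfd hzero hsub φ₀ hφ₀ t ht htS
    set ρ : ℂ := a + t₀ * I with hρ_def
    have ht₀ : t₀ ∈ Ioo c d := hsub (Finset.mem_coe.2 (Finset.mem_insert_self t₀ S'))
    have hsub' : ((S' : Set ℝ)) ⊆ Ioo c d :=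
      (Finset.coe_subset.2 (Finset.subset_insert t₀ S')).trans hsub
    have hρK : ρ ∈ Icc a b ×ℂ Icc c d :=
      ⟨by simpa [hρ_def] using hab.le, by simpa [hρ_def] using Ioo_subset_Icc_self ht₀⟩
    have htt₀ : t ≠ t₀ := fun h ↦ htS (h ▸ Finset.mem_insert_self t₀ S')
    have htS' : t ∉ S' := fun h ↦ htS (Finset.mem_insert_of_mem h)
    by_cases hfρ : f ρ ≠ 0
    · -- no zero at `ρ`
      have hzero' : ∀ y ∈ Icc c d, f (a + y * I) = 0 → y ∈ S' := by
        intro y hy h0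
        have h := hzero y hy h0
        rw [Finset.mem_insert] at h
        rcases h with h | h
        · exact absurd h0 (by rw [h]; exact hfρ)
        · exact h
      have horder : ((meromorphicOrderAt f (a + t₀ * I)).untop₀ : ℝ) = 0 := by
        rw [(hf ρ hρK).meromorphicOrderAt_eq, ((hf ρ hρK).analyticOrderAt_eq_zero).2 hfρ]
        simp
      have h := ih f hf hfc hfd hzero' hsub' φ₀ hφ₀ t ht htS'
      rw [Finset.filter_insert]
      by_cases hlt : t₀ < t
      · rwa [if_pos hlt, Finset.sum_insert (fun h' ↦ ht₀S' (Finset.mem_filter.1 h').1), horder,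
          zero_add]
      · rwa [if_neg hlt]
    push Not at hfρ
    -- a zero at `ρ`: divide out `(z - ρ)^m`
    have hcorner : ((a : ℂ) + c * I) ∈ Icc a b ×ℂ Icc c d :=
      ⟨by simpa using hab.le, by simpa using hcd.le⟩
    have hne_top : analyticOrderAt f ρ ≠ ⊤ :=
      analyticOrderAt_ne_top_of_reProdIm hab.le hcd.le hf hcorner hfc hρK
    obtain ⟨g, hg_an, hg_ne, hfg⟩ := (hf ρ hρK).analyticOrderAt_ne_top.mp hne_top
    set m : ℕ := analyticOrderNatAt f ρ with hm
    set f₁ : ℂ → ℂ := fun z ↦ if z = ρ then g ρ else f z / (z - ρ) ^ m with hf₁_def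
    have hf₁_of_ne : ∀ z, z ≠ ρ → f₁ z = f z / (z - ρ) ^ m := fun z hz ↦ by
      simp [hf₁_def, hz]
    have hf_eq : ∀ z, z ≠ ρ → f z = (z - ρ) ^ m * f₁ z := fun z hz ↦ by
      rw [hf₁_of_ne z hz, mul_div_cancel₀ _ (pow_ne_zero _ (sub_ne_zero.2 hz))]
    have hf₁ρ : f₁ =ᶠ[𝓝 ρ] g := by
      filter_upwards [hfg] with z hz
      by_cases hzρ : z = ρ
      · subst hzρ; simp [hf₁_def]
      · rw [hf₁_of_ne z hzρ, hz, smul_eq_mul, mul_div_cancel_left₀ _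
          (pow_ne_zero _ (sub_ne_zero.2 hzρ))]
    have hf_ev : ∀ z, z ≠ ρ → f =ᶠ[𝓝 z] fun w ↦ (w - ρ) ^ m * f₁ w := fun z hz ↦
      (isOpen_ne.eventually_mem hz).mono fun w hw ↦ hf_eq w hw
    have hf₁_an : AnalyticOnNhd ℂ f₁ (Icc a b ×ℂ Icc c d) := by
      intro z hz
      by_cases hzρ : z = ρ
      · subst hzρ
        exact hg_an.congr hf₁ρ.symm
      · have h1 : AnalyticAt ℂ (fun w ↦ f w / (w - ρ) ^ m) z :=
          (hf z hz).div ((analyticAt_id.sub analyticAt_const).pow m)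
            (pow_ne_zero _ (sub_ne_zero.2 hzρ))
        refine h1.congr ?_
        exact (isOpen_ne.eventually_mem hzρ).mono fun w hw ↦ (hf₁_of_ne w hw).symm
    have hf₁ρ_ne : f₁ ρ ≠ 0 := by simpa [hf₁_def] using hg_ne
    have hne_of : ∀ z, f z ≠ 0 → z ≠ ρ := fun z hz h ↦ hz (h ▸ hfρ)
    have hf₁_ne : ∀ z, f z ≠ 0 → f₁ z ≠ 0 := by
      intro z hz h0
      exact hz (by rw [hf_eq z (hne_of z hz), h0, mul_zero])
    have hfc₁ : f₁ (a + c * I) ≠ 0 := hf₁_ne _ hfc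
    have hfd₁ : f₁ (a + d * I) ≠ 0 := hf₁_ne _ hfd
    have hzero₁ : ∀ y ∈ Icc c d, f₁ (a + y * I) = 0 → y ∈ S' := by
      intro y hy h0
      have hyρ : (a : ℂ) + y * I ≠ ρ := fun h ↦ hf₁ρ_ne (h ▸ h0)
      have hfz : f (a + y * I) = 0 := by rw [hf_eq _ hyρ, h0, mul_zero]
      have h := hzero y hy hfz
      rw [Finset.mem_insert] at h
      rcases h with h | h
      · exact absurd (by rw [hρ_def, h]) hyρ
      · exact h
    -- points of the edge as `ρ + i(y - t₀)`
    have hedge : ∀ y : ℝ, ((a : ℂ) + y * I) - ρ = ((y - t₀ : ℝ) : ℂ) * I := fun y ↦ by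
      rw [hρ_def]; push_cast; ring
    have hedge_ne : ∀ y : ℝ, y ≠ t₀ → ((a : ℂ) + y * I) ≠ ρ := by
      intro y hy h
      have := congrArg Complex.im h
      simp [hρ_def] at this
      exact hy this
    -- the phase of `f₁` at the corner: `f₁(a+ic) = ‖f₁(a+ic)‖ e^{i(φ₀ + mπ/2)}`
    have hct₀ : 0 < t₀ - c := by linarith [ht₀.1]
    have hcρ : ((a : ℂ) + c * I) ≠ ρ := hedge_ne c (by linarith [ht₀.1])
    have hII : (-I : ℂ) ^ m * I ^ m = 1 := by rw [← mul_pow]; simp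
    set r : ℝ := (t₀ - c) ^ m with hr
    have hr0 : 0 < r := pow_pos hct₀ m
    have hfac : f (a + c * I) = (r : ℂ) * (-I) ^ m * f₁ (a + c * I) := by
      rw [hf_eq _ hcρ, hedge]
      congr 1
      rw [hr, ofReal_pow, ← mul_pow]
      congr 1
      push_cast
      ring
    have hnI : ‖(-I : ℂ) ^ m‖ = 1 := by rw [norm_pow, norm_neg, Complex.norm_I, one_pow]
    have hnorm_c : ‖f (a + c * I)‖ = r * ‖f₁ (a + c * I)‖ := by
      rw [hfac, norm_mul, norm_mul, hnI, mul_one, Complex.norm_real, Real.norm_of_nonneg hr0.le]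
    have hφ₁ : f₁ (a + c * I) = ‖f₁ (a + c * I)‖ * exp (((φ₀ + m * (Real.pi / 2) : ℝ) : ℂ) * I) := by
      have h := hφ₀
      rw [hnorm_c] at h
      rw [hfac] at h
      have hr' : (r : ℂ) ≠ 0 := by exact_mod_cast hr0.ne'
      have h1 : (-I : ℂ) ^ m * f₁ (a + c * I) = ‖f₁ (a + c * I)‖ * exp (φ₀ * I) := by
        apply mul_left_cancel₀ hr'
        rw [← mul_assoc, h]
        push_cast
        ring
      calc f₁ (a + c * I) = I ^ m * ((-I : ℂ) ^ m * f₁ (a + c * I)) := by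
            rw [← mul_assoc, mul_comm (I ^ m), hII, one_mul]
        _ = I ^ m * (‖f₁ (a + c * I)‖ * exp (φ₀ * I)) := by rw [h1]
        _ = ‖f₁ (a + c * I)‖ * exp (((φ₀ + m * (Real.pi / 2) : ℝ) : ℂ) * I) := by
            rw [I_pow_eq_exp, mul_left_comm, ← exp_add]
            congr 2
            push_cast
            ring
    -- induction hypothesis for `f₁`
    have hIH := ih f₁ hf₁_an hfc₁ hfd₁ hzero₁ hsub' (φ₀ + m * (Real.pi / 2)) hφ₁ t ht htS'
    -- the integral: `Re (f'/f) = Re (f₁'/f₁)` a.e. on the edge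
    have hleft_mem : ∀ y ∈ Icc c d, ((a : ℂ) + y * I) ∈ Icc a b ×ℂ Icc c d := fun y hy ↦
      ⟨by simpa using hab.le, by simpa using hy⟩
    have hsplit : ∀ z ∈ Icc a b ×ℂ Icc c d, z ≠ ρ → f z ≠ 0 →
        deriv f z / f z = (m : ℂ) * (z - ρ)⁻¹ + deriv f₁ z / f₁ z := by
      intro z hz hzρ hfz
      have hzρ' : z - ρ ≠ 0 := sub_ne_zero.2 hzρ
      have hf₁z : f₁ z ≠ 0 := hf₁_ne z hfz
      have hderiv : deriv f z = (m : ℂ) * (z - ρ) ^ (m - 1) * f₁ z + (z - ρ) ^ m * deriv f₁ z := by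
        rw [(hf_ev z hzρ).deriv_eq]
        have h1 : HasDerivAt (fun w : ℂ ↦ (w - ρ) ^ m) ((m : ℂ) * (z - ρ) ^ (m - 1) * 1) z :=
          ((hasDerivAt_id z).sub_const ρ).pow m
        have h2 : HasDerivAt f₁ (deriv f₁ z) z := (hf₁_an z hz).differentiableAt.hasDerivAt
        have h3 : HasDerivAt (fun w : ℂ ↦ (w - ρ) ^ m * f₁ w)
            ((m : ℂ) * (z - ρ) ^ (m - 1) * 1 * f₁ z + (z - ρ) ^ m * deriv f₁ z) z := h1.mul h2
        rw [h3.deriv]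
        ring
      rw [hderiv, natCast_mul_pow_pred₃ (z - ρ) hzρ' m, hf_eq z hzρ]
      field_simp
    have hae : ∀ᵐ y ∂volume, y ∈ Set.uIoc c t →
        (deriv f (a + y * I) / f (a + y * I)).re = (deriv f₁ (a + y * I) / f₁ (a + y * I)).re := by
      have h0 : volume ((insert t₀ S' : Finset ℝ) : Set ℝ) = 0 := Finset.measure_zero _ _
      filter_upwards [measure_eq_zero_iff_ae_notMem.1 h0] with y hy hyI
      rw [uIoc_of_le ht.1] at hyI
      have hyIcc : y ∈ Icc c d := ⟨hyI.1.le, hyI.2.trans ht.2⟩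
      have hfy : f (a + y * I) ≠ 0 := fun h ↦ hy (hzero y hyIcc h)
      have hyρ : (a : ℂ) + y * I ≠ ρ := hne_of _ hfy
      rw [hsplit _ (hleft_mem y hyIcc) hyρ hfy, add_re, hρ_def,
        re_inv_sub_vertical_eq_zero a t₀ y (m : ℂ) (by simp), zero_add]
    have e_int : ∫ y in c..t, (deriv f (a + y * I) / f (a + y * I)).re =
        ∫ y in c..t, (deriv f₁ (a + y * I) / f₁ (a + y * I)).re :=
      intervalIntegral.integral_congr_ae hae
    -- the orders: `m` at `ρ`, equal elsewhere on the edge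
    have horder_ρ : ((meromorphicOrderAt f (a + t₀ * I)).untop₀ : ℝ) = m := by
      rw [← hρ_def, (hf ρ hρK).meromorphicOrderAt_eq, ← Nat.cast_analyticOrderNatAt hne_top]
      simp [hm]
    have horder_eq : ∀ z ∈ Icc a b ×ℂ Icc c d, z ≠ ρ →
        meromorphicOrderAt f z = meromorphicOrderAt f₁ z := by
      intro z hz hne
      have h1 : meromorphicOrderAt f z = meromorphicOrderAt (fun w ↦ (w - ρ) ^ m * f₁ w) z :=
        meromorphicOrderAt_congr ((hf_ev z hne).filter_mono nhdsWithin_le_nhds)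
      have hpow_an : AnalyticAt ℂ (fun w : ℂ ↦ (w - ρ) ^ m) z :=
        (analyticAt_id.sub analyticAt_const).pow m
      have h2 : meromorphicOrderAt (fun w ↦ (w - ρ) ^ m * f₁ w) z =
          meromorphicOrderAt (fun w : ℂ ↦ (w - ρ) ^ m) z + meromorphicOrderAt f₁ z :=
        fun_meromorphicOrderAt_mul hpow_an.meromorphicAt (hf₁_an z hz).meromorphicAt
      have h3 : meromorphicOrderAt (fun w : ℂ ↦ (w - ρ) ^ m) z = 0 := by
        rw [hpow_an.meromorphicOrderAt_eq,
          (hpow_an.analyticOrderAt_eq_zero.2 (pow_ne_zero _ (sub_ne_zero.2 hne)))]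
        simp
      rw [h1, h2, h3, zero_add]
    have e_sum_S' : ∑ s ∈ S'.filter (· < t), ((meromorphicOrderAt f (a + s * I)).untop₀ : ℝ) =
        ∑ s ∈ S'.filter (· < t), ((meromorphicOrderAt f₁ (a + s * I)).untop₀ : ℝ) := by
      refine Finset.sum_congr rfl fun s hs ↦ ?_
      have hs' := (Finset.mem_filter.1 hs).1
      have hne : (a : ℂ) + s * I ≠ ρ := hedge_ne s (fun h ↦ ht₀S' (h ▸ hs'))
      rw [horder_eq _ (hleft_mem s (Ioo_subset_Icc_self (hsub' (Finset.mem_coe.2 hs')))) hne]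
    -- the factor `(i(t - t₀))^m` and the assembly, according to the side of `t₀`
    have htρ : ((a : ℂ) + t * I) ≠ ρ := hedge_ne t htt₀
    rw [Finset.filter_insert]
    rcases lt_or_gt_of_ne htt₀ with hlt | hgt
    · -- `t < t₀`: no jump yet; `(i(t-t₀))^m = (t₀-t)^m (-i)^m` cancels the shift of `φ₀`
      set q : ℝ := (t₀ - t) ^ m with hq
      have hq0 : 0 < q := pow_pos (by linarith) m
      have hfac_t : f (a + t * I) = (q : ℂ) * (-I) ^ m * f₁ (a + t * I) := by
        rw [hf_eq _ htρ, hedge]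
        congr 1
        rw [hq, ofReal_pow, ← mul_pow]
        congr 1
        push_cast
        ring
      have hnI : ‖(-I : ℂ) ^ m‖ = 1 := by rw [norm_pow, norm_neg, Complex.norm_I, one_pow]
      have hnorm_t : ((‖f (a + t * I)‖ : ℝ) : ℂ) = (q : ℂ) * ‖f₁ (a + t * I)‖ := by
        rw [hfac_t, norm_mul, norm_mul, hnI, mul_one, Complex.norm_real, Real.norm_of_nonneg hq0.le,
          Complex.ofReal_mul]
      rw [if_neg (not_lt.2 hlt.le), e_sum_S', e_int, hnorm_t, hfac_t, hIH,
        norm_ofReal_norm_mul_exp_mul_I, neg_I_pow_eq_exp]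
      generalize (∫ u in c..t, (deriv f₁ (a + u * I) / f₁ (a + u * I)).re) = J
      generalize (∑ s ∈ S'.filter (· < t), ((meromorphicOrderAt f₁ (a + s * I)).untop₀ : ℝ)) = SUM
      rw [mul_mul_mul_comm, exp_ofReal_mul_I_mul_exp,
        show (-(m * (Real.pi / 2)) : ℝ) + (φ₀ + m * (Real.pi / 2) + J + Real.pi * SUM) =
          φ₀ + J + Real.pi * SUM by ring]
    · -- `t₀ < t`: the jump `+mπ`; `(i(t-t₀))^m = (t-t₀)^m i^m`
      set q : ℝ := (t - t₀) ^ m with hq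
      have hq0 : 0 < q := pow_pos (by linarith) m
      have hfac_t : f (a + t * I) = (q : ℂ) * I ^ m * f₁ (a + t * I) := by
        rw [hf_eq _ htρ, hedge, hq, ofReal_pow, ← mul_pow]
      have hnI : ‖(I : ℂ) ^ m‖ = 1 := by rw [norm_pow, Complex.norm_I, one_pow]
      have hnorm_t : ((‖f (a + t * I)‖ : ℝ) : ℂ) = (q : ℂ) * ‖f₁ (a + t * I)‖ := by
        rw [hfac_t, norm_mul, norm_mul, hnI, mul_one, Complex.norm_real, Real.norm_of_nonneg hq0.le,
          Complex.ofReal_mul]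
      rw [if_pos hgt, Finset.sum_insert (fun h' ↦ ht₀S' (Finset.mem_filter.1 h').1), horder_ρ,
        e_sum_S', e_int, hnorm_t, hfac_t, hIH, norm_ofReal_norm_mul_exp_mul_I, I_pow_eq_exp]
      generalize (∫ u in c..t, (deriv f₁ (a + u * I) / f₁ (a + u * I)).re) = J
      generalize (∑ s ∈ S'.filter (· < t), ((meromorphicOrderAt f₁ (a + s * I)).untop₀ : ℝ)) = SUM
      rw [mul_mul_mul_comm, exp_ofReal_mul_I_mul_exp,
        show (m * (Real.pi / 2) : ℝ) + (φ₀ + m * (Real.pi / 2) + J + Real.pi * SUM) =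
          φ₀ + J + Real.pi * ((m : ℝ) + SUM) by ring]

/-! ## The phase at a zero of the edge -/

/-- **The left value of the phase at a zero.** In the setting of `leftEdge_phase_eq_sum`
(`f` analytic on the closed rectangle, `f(a+ic) ≠ 0 ≠ f(a+id)`, `S ⊆ (c,d)` a finite set containing
the ordinates of the zeros of `f` on the left edge, `f(a+ic) = ‖f(a+ic)‖ e^{iφ₀}`), assume moreover
that `t ↦ Re (f'/f)(a+it)` is integrable on `[c, d]`
(`Literature.Analysis.Complex.intervalIntegrable_re_logDeriv_left`). Let `t₀ ∈ S` with
`f = (s − ρ)ⁿ g` near `ρ = a + it₀`, `g` analytic at `ρ`, `g(ρ) ≠ 0`. Then the left value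
`Φ(t₀⁻) = φ₀ + ∫_c^{t₀} Re (f'/f)(a+iu) du + π Σ_{s ∈ S, s < t₀} m(a+is)` of the phase satisfies
`e^{iΦ(t₀⁻)} = (−i)ⁿ g(ρ)/‖g(ρ)‖`: below `t₀`, `f(a+it)/‖f(a+it)‖ = (−i)ⁿ g(a+it)/‖g(a+it)‖`
(`leftEdge_phase_eq_sum` and `(i(t−t₀))ⁿ = (t₀−t)ⁿ(−i)ⁿ`), and both sides are continuous from the
left at `t₀`. [cite: Conrey1983, §4 (after (1))] -/
theorem exp_leftEdge_phase_at_zero (hab : a < b) (hcd : c < d) (S : Finset ℝ) {f : ℂ → ℂ}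
    (hf : AnalyticOnNhd ℂ f (Icc a b ×ℂ Icc c d)) (hfc : f (a + c * I) ≠ 0) (hfd : f (a + d * I) ≠ 0)
    (hzero : ∀ y ∈ Icc c d, f (a + y * I) = 0 → y ∈ S) (hsub : (S : Set ℝ) ⊆ Ioo c d)
    (hint : IntervalIntegrable (fun u : ℝ ↦ (deriv f (a + u * I) / f (a + u * I)).re) volume c d)
    {φ₀ : ℝ} (hφ₀ : f (a + c * I) = ‖f (a + c * I)‖ * exp (φ₀ * I))
    {t₀ : ℝ} (ht₀ : t₀ ∈ S) {n : ℕ} {g : ℂ → ℂ} (hg : AnalyticAt ℂ g (a + t₀ * I))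
    (hg0 : g (a + t₀ * I) ≠ 0)
    (hfg : ∀ᶠ z in 𝓝 ((a : ℂ) + t₀ * I), f z = (z - (a + t₀ * I)) ^ n * g z) :
    exp (((φ₀ + (∫ u in c..t₀, (deriv f (a + u * I) / f (a + u * I)).re) +
        Real.pi * ∑ s ∈ S.filter (· < t₀), ((meromorphicOrderAt f (a + s * I)).untop₀ : ℝ) : ℝ) : ℂ) * I) =
      (-I) ^ n * (g (a + t₀ * I) / ‖g (a + t₀ * I)‖) := by
  set ρ : ℂ := (a : ℂ) + t₀ * I with hρ
  have ht₀I : t₀ ∈ Ioo c d := hsub (Finset.mem_coe.2 ht₀)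
  set C : ℝ := Real.pi * ∑ s ∈ S.filter (· < t₀), ((meromorphicOrderAt f (a + s * I)).untop₀ : ℝ)
    with hC
  -- the two functions whose left limits at `t₀` we compare
  set F : ℝ → ℂ := fun t ↦
    exp (((φ₀ + (∫ u in c..t, (deriv f (a + u * I) / f (a + u * I)).re) + C : ℝ) : ℂ) * I) with hF
  set G : ℝ → ℂ := fun t ↦ (-I) ^ n * (g (a + t * I) / ‖g (a + t * I)‖) with hG
  have hlin : Continuous fun t : ℝ ↦ (a : ℂ) + t * I := by fun_prop
  have hlin_t₀ : Tendsto (fun t : ℝ ↦ (a : ℂ) + t * I) (𝓝 t₀) (𝓝 ρ) := hlin.tendsto t₀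
  -- (1) `F → F t₀` and `G → G t₀` along `𝓝[<] t₀`
  have hprim : ContinuousOn (fun t ↦ ∫ u in c..t, (deriv f (a + u * I) / f (a + u * I)).re) (Icc c d) := by
    have h := intervalIntegral.continuousOn_primitive_interval' hint (left_mem_uIcc)
    rwa [uIcc_of_le hcd.le] at h
  have hFt : Tendsto F (𝓝[<] t₀) (𝓝 (F t₀)) := by
    have h1 : ContinuousWithinAt F (Icc c d) t₀ := by
      have hp := (hprim t₀ (Ioo_subset_Icc_self ht₀I))
      have h2 : ContinuousWithinAt
          (fun t : ℝ ↦ (φ₀ + (∫ u in c..t, (deriv f (a + u * I) / f (a + u * I)).re) + C : ℝ))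
          (Icc c d) t₀ :=
        (continuousWithinAt_const.add hp).add continuousWithinAt_const
      exact ((Complex.continuous_ofReal.continuousAt.comp_continuousWithinAt h2).mul
        continuousWithinAt_const).cexp
    have h3 : ContinuousWithinAt F (Ioo c t₀) t₀ :=
      h1.mono fun t ht ↦ ⟨ht.1.le, ht.2.le.trans ht₀I.2.le⟩
    rwa [ContinuousWithinAt, nhdsWithin_Ioo_eq_nhdsLT ht₀I.1] at h3
  have hGt : Tendsto G (𝓝[<] t₀) (𝓝 (G t₀)) := by
    have hga : ContinuousAt (fun t : ℝ ↦ g (a + t * I)) t₀ :=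
      hg.continuousAt.comp (f := fun t : ℝ ↦ (a : ℂ) + t * I) hlin.continuousAt
    have h1 : ContinuousAt G t₀ := by
      refine (hga.div ?_ ?_).const_mul _
      · exact Complex.continuous_ofReal.continuousAt.comp hga.norm
      · exact_mod_cast (norm_ne_zero_iff.2 hg0)
    exact h1.continuousWithinAt
  -- (2) `F = G` eventually along `𝓝[<] t₀`
  have hev_fac : ∀ᶠ t : ℝ in 𝓝 t₀, f (a + t * I) = ((a : ℂ) + t * I - ρ) ^ n * g (a + t * I) :=
    hlin_t₀.eventually hfg
  have hev_g : ∀ᶠ t : ℝ in 𝓝 t₀, g (a + t * I) ≠ 0 :=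
    hlin_t₀.eventually (hg.continuousAt.eventually_ne hg0)
  have hev_S : ∀ᶠ t in 𝓝[<] t₀, ∀ s ∈ S, s < t₀ → s < t := by
    rw [Filter.eventually_all_finset]
    intro s hs
    by_cases hst : s < t₀
    · exact ((eventually_gt_nhds hst).mono fun t ht _ ↦ ht).filter_mono nhdsWithin_le_nhds
    · exact Eventually.of_forall fun t h ↦ absurd h hst
  have hev_I : ∀ᶠ t in 𝓝[<] t₀, t ∈ Ioo c t₀ := Ioo_mem_nhdsLT ht₀I.1
  have hFG : F =ᶠ[𝓝[<] t₀] G := by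
    filter_upwards [hev_I, hev_S, hev_fac.filter_mono nhdsWithin_le_nhds,
      hev_g.filter_mono nhdsWithin_le_nhds] with t htI htS htfac htg
    have htIcc : t ∈ Icc c d := ⟨htI.1.le, htI.2.le.trans ht₀I.2.le⟩
    have htS' : t ∉ S := fun h ↦ lt_irrefl t (htS t h htI.2)
    have hfilt : S.filter (· < t) = S.filter (· < t₀) := by
      ext s
      simp only [Finset.mem_filter, and_congr_right_iff]
      exact fun hs ↦ ⟨fun h ↦ h.trans htI.2, fun h ↦ htS s hs h⟩
    have hph := leftEdge_phase_eq_sum hab hcd S f hf hfc hfd hzero hsub φ₀ hφ₀ t htIcc htS'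
    rw [hfilt] at hph
    -- `f(a+it) = (t₀ - t)^n (-i)^n g(a+it)`
    set q : ℝ := (t₀ - t) ^ n with hq
    have hq0 : 0 < q := pow_pos (by linarith [htI.2]) n
    have hfac_t : f (a + t * I) = (q : ℂ) * (-I) ^ n * g (a + t * I) := by
      rw [htfac]
      congr 1
      rw [hq, ofReal_pow, ← mul_pow]
      congr 1
      rw [hρ]
      push_cast
      ring
    have hnI : ‖(-I : ℂ) ^ n‖ = 1 := by rw [norm_pow, norm_neg, Complex.norm_I, one_pow]
    have hnorm_t : ((‖f (a + t * I)‖ : ℝ) : ℂ) = (q : ℂ) * ‖g (a + t * I)‖ := by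
      rw [hfac_t, norm_mul, norm_mul, hnI, mul_one, Complex.norm_real, Real.norm_of_nonneg hq0.le,
        Complex.ofReal_mul]
    have hne : ((‖f (a + t * I)‖ : ℝ) : ℂ) ≠ 0 := by
      rw [hnorm_t]
      exact mul_ne_zero (by exact_mod_cast hq0.ne') (by exact_mod_cast norm_ne_zero_iff.2 htg)
    -- divide the phase identity by `‖f(a+it)‖`
    have hph' : F t = f (a + t * I) / ‖f (a + t * I)‖ := by
      rw [eq_div_iff hne, mul_comm]
      exact hph.symm
    rw [hph', hnorm_t, hfac_t, hG]
    have hq' : (q : ℂ) ≠ 0 := by exact_mod_cast hq0.ne'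
    have hg' : ((‖g (a + t * I)‖ : ℝ) : ℂ) ≠ 0 := by exact_mod_cast norm_ne_zero_iff.2 htg
    field_simp
  -- (3) conclude
  have h := tendsto_nhds_unique_of_eventuallyEq hFt hGt hFG
  simpa only [hF, hG, hC] using h

end Literature.Analysis.Complex

end
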